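import Summits.NavierStokesRegularity.NavierStokesRegularity.Theorems.RellichScarScarRigidityApexMild
import Literature.Analysis.FluidPDE.TypeIAncientMildClassical
import Literature.Analysis.FluidPDE.PineauVicolRSSChaeWolf

/-!
# Crux `SymmetricScarExists` (stmt-NavierStokesRegularity-11718), line `logtime-bernoulli-certificate`:
# stub `stub_apexClassicalRepresentative` — an apex Type-I suitable weak profile has a classical
# representative on `(−∞, 0)`

Helper file (`--supports stmt-NavierStokesRegularity-11718`; theorems only, no definitions, no named
facts, no hypotheses beyond the registered signature).  It proves the registered stub
`stub_apexClassicalRepresentative` = hypothesis (hRep) of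
`apexLerayProfile_of_representative_of_bounds` (`…Theorems/RellichScarSymmetricScarExistsApexLerayProfile.lean`):
a suitable weak solution `(u, p)` of Navier–Stokes (`ν = 1`, `f = 0`) on the slab `(−∞,0) × ℝ³` with a
weak spatial gradient `G`, `𝐈(ℝ³ × ℝ₋) < ∞` and the POINTWISE Type-I bound
`‖u(t,x)‖ ≤ C/(‖x‖ + √(−t))` agrees a.e. on the slab (product Lebesgue measure restricted to
`Iio 0 ×ˢ univ`) with a CLASSICAL solution `(v, q)` on `Iio 0` (jointly `C^∞`, equations pointwise).

Proof (Koch–Nadirashvili–Seregin–Šverák 2009, Lemma 3.1 p. 7 and Prop. 4.1 p. 8; three tree facts,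
all proved):

1. `stub_apexMildRepresentative` (sibling crux `ScarRigidity`, file
   `…Theorems/RellichScarScarRigidityApexMild.lean`): on each window `(a, b) ⋐ (−∞, 0)` the field is a
   bounded weak solution, hence drift-mild `u = U + b(t)` (Lemma 3.1); the decay `‖x‖‖u‖ ≤ C` kills the
   parasitic drift; bounded mild ⇒ smooth (Prop. 4.1); the window representatives patch to ONE field
   `V`, `V = u` a.e. on the slab, in the class `IsTypeIAncientMild` (jointly smooth on `t < 0`,
   divergence free, Oseen–Duhamel formula between all pairs of negative times, Type-I rate).  It wants
   `0 < C`; we feed it the constant `C + 1` (`HasTypeIDecay` is monotone in the constant —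
   `hasTypeIDecay_mono` of `…Theorems/ScarRigidity/Negative/LogicAndLoadBearing.lean` — and forces
   `0 ≤ C`, `nonneg_of_hasTypeIDecay`).
2. `IsTypeIAncientMild.exists_isClassicalNSSolutionOn_Ioo` (`TypeIAncientMildClassical.lean`): on every
   window `(−(k+1), 0)` the field `V` is a classical solution for SOME smooth pressure `q_k`
   (Fabes–Jones–Rivière: smooth bounded mild ⇒ classical).
3. `IsClassicalNSSolutionOn.exists_pressure_Iio_of_Ioo` (`PineauVicolRSSChaeWolf.lean`): the same
   velocity on an exhausting family of windows with pressures `q_k` is classical on `Iio 0` with ONE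
   pressure (the momentum equations force `∇q_j = ∇q_k` on overlaps, so the normalised pressures
   `q_k(t,x) − q_k(t,0)` patch; smoothness is local).

What is NOT here: nothing about the pressure `p` of the given pair (the classical pressure `q` is a
normalised one attached to the representative `V`; the neighbour stub `stub_apexScaleInvariantBounds`
re-chooses the Riesz pressure anyway), and no use of `𝐈 < ∞` / `G` beyond passing them on.

## References

* G. Koch, N. Nadirashvili, G. Seregin, V. Šverák, *Liouville theorems for the Navier–Stokes equations
  and applications*, Acta Math. 203 (2009) 83–105 = arXiv:0709.3599, Lemma 3.1 p. 7, §4 Prop. 4.1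
  and (4.10)–(4.11) p. 8. [KochNadirashviliSereginSverak2009]
* E. B. Fabes, B. F. Jones, N. M. Rivière, Arch. Rational Mech. Anal. 45 (1972) 222–240, Thm. 2.1.
  [FabesJonesRiviere1972]
* D. Albritton, T. Barker, J. Math. Fluid Mech. 21 (2019) = arXiv:1811.00502, §3. [AlbrittonBarker2019]
-/

noncomputable section

open MeasureTheory Set Function Filter Topology

namespace Summit.NavierStokesRegularity.NavierStokesRegularity.Theorems.SymmetricScarExists.LogtimeBernoulli

open Literature.Analysis.FluidPDE
open Summit.NavierStokesRegularity.NavierStokesRegularity.Theorems.RellichScarScarRigidity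
  (stub_apexMildRepresentative)
open Summit.NavierStokesRegularity.NavierStokesRegularity.Theorems.ScarRigidity.Negative
  (hasTypeIDecay_mono)

/-- **A Type-I ancient mild field is a classical solution on the whole past `(−∞, 0)`** for some
smooth pressure (`ν = 1`, `f = 0`): classical on every window `(−(k+1), 0)` with some pressure
(`IsTypeIAncientMild.exists_isClassicalNSSolutionOn_Ioo`, Fabes–Jones–Rivière), and the pressures of
one velocity on an exhausting family of windows patch after normalisation at the spatial origin
(`IsClassicalNSSolutionOn.exists_pressure_Iio_of_Ioo`). [cite: FabesJonesRiviere1972, Thm. 2.1] -/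
theorem exists_isClassicalNSSolutionOn_Iio_of_isTypeIAncientMild {C : ℝ}
    {V : ℝ → EuclideanSpace ℝ (Fin 3) → EuclideanSpace ℝ (Fin 3)} (hV : IsTypeIAncientMild C V) :
    ∃ q : ℝ → EuclideanSpace ℝ (Fin 3) → ℝ, IsClassicalNSSolutionOn (Iio 0) 1 0 V q := by
  have hwin : ∀ k : ℕ, ∃ q : ℝ → EuclideanSpace ℝ (Fin 3) → ℝ,
      IsClassicalNSSolutionOn (Ioo (-((k : ℝ) + 1)) 0) 1 0 V q := fun k =>
    hV.exists_isClassicalNSSolutionOn_Ioo (t₀ := -((k : ℝ) + 1)) (by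
      have : (0 : ℝ) ≤ k := Nat.cast_nonneg k
      linarith)
  choose q hq using hwin
  refine IsClassicalNSSolutionOn.exists_pressure_Iio_of_Ioo (a := fun k : ℕ => -((k : ℝ) + 1)) hq
    fun t ht => ⟨⌈-t⌉₊, ?_⟩
  have h1 : -t ≤ (⌈-t⌉₊ : ℝ) := Nat.le_ceil (-t)
  show -((⌈-t⌉₊ : ℝ) + 1) < t
  linarith

/-- **Registered stub `stub_apexClassicalRepresentative` (hypothesis (hRep) of
`apexLerayProfile_of_representative_of_bounds`).**  A suitable weak solution `(u, p)` of
Navier–Stokes (`ν = 1`, `f = 0`) on the slab `(−∞,0) × ℝ³` with a weak spatial gradient `G`,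
`𝐈(ℝ³ × ℝ₋) < ∞` and the pointwise Type-I bound `‖u(t,x)‖ ≤ C/(‖x‖ + √(−t))` agrees a.e. on the slab
with a CLASSICAL solution `(v, q)` on `(−∞, 0)`.  Proof: Koch–Nadirashvili–Seregin–Šverák 2009,
Lemma 3.1 (bounded weak = drift-mild, the spatial decay killing the parasitic drift) and Prop. 4.1
(bounded mild ⇒ smooth), as assembled in the sibling crux's `stub_apexMildRepresentative` (with the
constant `C + 1 > 0`), give a Type-I ancient mild representative `V = u` a.e.; it is classical on
`(−∞, 0)` for one normalised pressure (`exists_isClassicalNSSolutionOn_Iio_of_isTypeIAncientMild`).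
[cite: KochNadirashviliSereginSverak2009, Lemma 3.1 p. 7 and §4 Prop. 4.1 p. 8 (arXiv:0709.3599)] -/
theorem stub_apexClassicalRepresentative :
    ∀ (u : ℝ → EuclideanSpace ℝ (Fin 3) → EuclideanSpace ℝ (Fin 3)) (p : ℝ → EuclideanSpace ℝ (Fin 3) → ℝ) (G : ℝ → EuclideanSpace ℝ (Fin 3) → EuclideanSpace ℝ (Fin 3) →L[ℝ] EuclideanSpace ℝ (Fin 3)) (C : ℝ), Literature.Analysis.FluidPDE.IsSuitableWeakSolutionOn (Literature.Analysis.FluidPDE.slab (EuclideanSpace ℝ (Fin 3)) (Set.Iio 0) isOpen_Iio) 1 0 u p → Literature.Analysis.FluidPDE.HasWeakSpatialGradientOn (Literature.Analysis.FluidPDE.slab (EuclideanSpace ℝ (Fin 3)) (Set.Iio 0) isOpen_Iio) u G → Literature.Analysis.FluidPDE.typeIBound (Set.Iio (0 : ℝ) ×ˢ Set.univ) u p G < ⊤ → Literature.Analysis.FluidPDE.HasTypeIDecay C u → ∃ (v : ℝ → EuclideanSpace ℝ (Fin 3) → EuclideanSpace ℝ (Fin 3)) (q : ℝ → EuclideanSpace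 ℝ (Fin 3) → ℝ), Literature.Analysis.FluidPDE.IsClassicalNSSolutionOn (Set.Iio 0) 1 0 v q ∧ Function.uncurry v =ᵐ[MeasureTheory.volume.restrict (Set.Iio (0 : ℝ) ×ˢ (Set.univ : Set (EuclideanSpace ℝ (Fin 3))))] Function.uncurry u := by
  intro u p G C hsw hwg hI hdec
  have hC1 : 0 < C + 1 := by linarith [nonneg_of_hasTypeIDecay hdec]
  obtain ⟨V, hae, hmild, -⟩ :=
    stub_apexMildRepresentative u p G (C + 1) hC1 hsw hwg hI (hasTypeIDecay_mono (by linarith) hdec)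
  obtain ⟨q, hcl⟩ := exists_isClassicalNSSolutionOn_Iio_of_isTypeIAncientMild hmild
  exact ⟨V, q, hcl, hae⟩

end Summit.NavierStokesRegularity.NavierStokesRegularity.Theorems.SymmetricScarExists.LogtimeBernoulli

end
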